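import Literature.Analysis.FluidPDE.NSVorticityBKMTools
import Literature.Analysis.FluidPDE.NormalisedPressureDischarge
import Literature.Analysis.FluidPDE.NormalisedPressureL2Finite
import Literature.Analysis.FluidPDE.TaoEnstrophyIdentity
import HarnessLib

/-!
# The Beale–Kato–Majda a priori estimate, III: the energy inequality for classical solutions in
# the BKM class, `ν ≥ 0`

Analysis/FluidPDE support file (theorems only, no definitions, no named facts) on the discharge
path of `Literature.Analysis.FluidPDE.MajdaBertozzi2002_bkmAprioriH3` (`NSVorticityBKM.lean`;
Majda–Bertozzi, *Vorticity and Incompressible Flow*, CUP 2002, §3.3). The `m = 0` level of the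
`H^m` bound (3.79) of the proof of Thm. 3.6 is the basic energy estimate of §3.1, Prop. 3.1 with
(3.7) (`ν ≥ 0`, no forcing): `sup_t ‖v(t)‖₀ ≤ ‖v₀‖₀`, obtained there by pairing the equations
with `v` and integrating by parts, "`−(∇p̃, ṽ) = (p̃, div ṽ) = 0`" for solutions "that vanish
sufficiently rapidly as `|x| ↗ ∞`". The tree's class `IsClassicalNSSolutionOn` puts no condition
on the pressure and no decay on `∂ₜu`; in the Beale–Kato–Majda class (all Sobolev seminorms of
`u` bounded on the slab) the pressure is nevertheless canonical — `p(t) = Q[u(t)] + c(t)` at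
interior times, `Q` the normalised (Newtonian) pressure, by Tao's normalisation lemma, proved in
the tree for `ν ≥ 0` (`pressure_sub_pressurePotential_eq`, `NormalisedPressureDischarge.lean`) —
and `Q[u(t)] ∈ L²` with `‖Q‖₂ ≤ 27M_λ ‖|u|²‖₂` (`eLpNorm_normalisedPressure_le_of_integrable`,
Stein's `L²` bound). This is what makes the printed integration by parts available:

* `transport_weight_le`, `viscous_weight_le`, `integral_inner_gradient_smul_eq`,
  `pressure_weight_le` — the three pairings of the momentum equation with `φ u`, `φ = χ_R⁴` a
  cutoff with `‖Dφ‖ ≤ c`: transport `−∫φ⟪(u·∇)u, u⟫ = ½∫|u|² ∂ᵤφ ≤ ½ c B ∫|u|²`, viscosity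
  `∫φ⟪Δu, u⟫ ≤ 3c (∫|u|² + ∫|Du|²)/2` (`integral_inner_convect_mul_weight`,
  `integral_inner_laplacian_mul_weight`), pressure `−∫⟪∇p, φu⟫ = ∫ (Q + c₀) ⟪u, ∇φ⟫ = ∫ Q ⟪u, ∇φ⟫`
  (`div u = 0`) `≤ c (∫Q² + ∫|u|²)/2`;
* `IsClassicalNSSolutionOn.bkm_energy_le` — **the energy inequality**: for `ν ≥ 0`, `T > 0` and
  an unforced classical solution on `[0, T] × ℝ³` with all Sobolev seminorms bounded on `[0, T]`,
  `∫|u(t)|² ≤ ∫|u(0)|²` for every `t ∈ [0, T]` (localised balance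
  `∫χ_R⁴|u(t)|² − ∫χ_R⁴|u(0)|² = 2∫₀ᵗ∫χ_R⁴⟪∂ₜu, u⟫`, the three pairings are `O(1/R)` uniformly
  on the slab, and `R → ∞` by dominated convergence).

## Mathlib / tree search

Tree (all used): `pressure_sub_pressurePotential_eq` (`NormalisedPressureDischarge`, `ν ≥ 0`);
`normalisedPressure_eq_pressurePotential` (`PressureRepresentation`);
`eLpNorm_normalisedPressure_le_of_integrable`, `aestronglyMeasurable_normalisedPressure_of_integrable`
(`NormalisedPressureL2Finite`); `integral_inner_convect_mul_weight`,
`integral_inner_laplacian_mul_weight` (`TaoEnstrophyIdentity`);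
`IsSmoothSpaceTimeOn.integral_Ioo_integral_mul_inner_timeDerivWithin`,
`continuousOn_integral_mul_of_continuousOn` (`EnergyToolkit`);
`integral_inner_gradient_eq_neg_integral_mul_divergence`, `integral_mul_divergence_add_eq_zero_left`,
`divergence_smul_apply`, `cutoff`, `exists_norm_fderiv_cutoff_le` (`WholeSpaceIBP`);
`sq_norm_fderiv_le_levelSq_one` (`NSVorticitySlice`); `levelSq_bounds_of_hasBoundedSobolevNormsOn`,
`exists_forall_norm_iteratedFDeriv_le_bkmClass`, `tendsto_integral_cutoff_pow_mul_atTop`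
(`NSVorticityBKMTools`); `eLpNorm_two_le_rpow_of_lintegral_sq_le` (`TaoLocalisationProofs`).
Mathlib: `MemLp.eLpNorm_eq_integral_rpow_norm`, `memLp_two_iff_integrable_sq`,
`lipschitzWith_of_nnnorm_fderiv_le`, `setIntegral_mono_on`, `HasFDerivAt.pow`.

## References

* A. J. Majda, A. L. Bertozzi, *Vorticity and Incompressible Flow*, CUP 2002, §3.1.1 Prop. 3.1
  with (3.5)–(3.7) (p. 88); §3.3 (3.79) with `m = 0` (p. 116). [MajdaBertozzi2002]
* T. Tao, Anal. PDE 6 (2013) = arXiv:1108.1165, Lemma 4.1 (i) (pressure normalisation) and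
  Lemma 8.1 (energy inequality for smooth finite-energy solutions). [Tao2011]
-/

noncomputable section

open MeasureTheory Set Function Filter Metric
open _root_.Topology
open scoped ENNReal NNReal ContDiff RealInnerProductSpace

namespace Literature.Analysis.FluidPDE

/-! ## Real `L²` bounds from `eLpNorm` bounds -/

section L2

variable {α : Type*} [MeasurableSpace α] {μ : Measure α}

/-- From `‖f‖_{L²} ≤ A < ∞` (as an `eLpNorm` bound) to `f² ∈ L¹` with `∫ f² ≤ A.toReal²`.
[folklore] -/
theorem integrable_sq_and_integral_le_of_eLpNorm_le {f : α → ℝ} (hf : AEStronglyMeasurable f μ)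
    {A : ℝ≥0∞} (hA : A ≠ ⊤) (h : eLpNorm f 2 μ ≤ A) :
    Integrable (fun x => f x ^ 2) μ ∧ ∫ x, f x ^ 2 ∂μ ≤ A.toReal ^ 2 := by
  have hmem : MemLp f 2 μ := ⟨hf, h.trans_lt hA.lt_top⟩
  refine ⟨(memLp_two_iff_integrable_sq hf).1 hmem, ?_⟩
  have hI0 : 0 ≤ ∫ x, f x ^ 2 ∂μ := integral_nonneg fun x => sq_nonneg _
  have heq := hmem.eLpNorm_eq_integral_rpow_norm two_ne_zero ENNReal.ofNat_ne_top
  rw [ENNReal.toReal_ofNat] at heq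
  have hrpow : ∫ x, ‖f x‖ ^ (2 : ℝ) ∂μ = ∫ x, f x ^ 2 ∂μ :=
    integral_congr_ae (Eventually.of_forall fun x => by
      simp only [Real.rpow_two, Real.norm_eq_abs, sq_abs])
  rw [hrpow] at heq
  have h1 : ENNReal.ofReal ((∫ x, f x ^ 2 ∂μ) ^ (2 : ℝ)⁻¹) ≤ A := heq ▸ h
  have h2 : (∫ x, f x ^ 2 ∂μ) ^ (2 : ℝ)⁻¹ ≤ A.toReal := (ENNReal.ofReal_le_iff_le_toReal hA).1 h1
  have h3 := pow_le_pow_left₀ (Real.rpow_nonneg hI0 _) h2 2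
  have e : ((∫ x, f x ^ 2 ∂μ) ^ (2 : ℝ)⁻¹) ^ 2 = ∫ x, f x ^ 2 ∂μ := by
    exact_mod_cast Real.rpow_inv_natCast_pow hI0 (n := 2) (by norm_num)
  rwa [e] at h3

/-- **The normalised pressure of a bounded finite-energy smooth field is in `L²`**, with
`∫ Q[w]² ≤ (27M_λ)² B₀² ∫|w|²` when `|w| ≤ B₀` (Stein's `L²` bound
`‖Q[w]‖₂ ≤ 27M_λ ‖|w|²‖₂`, `eLpNorm_normalisedPressure_le_of_integrable`, and
`‖|w|²‖₂² ≤ B₀² ∫|w|²`). [folklore] -/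
theorem integral_normalisedPressure_sq_le_of_bound {w : EuclideanSpace ℝ (Fin 3) → EuclideanSpace ℝ (Fin 3)}
    (hw : ContDiff ℝ ∞ w) (hE : Integrable fun y => ‖w y‖ ^ 2) {I₀ B₀ : ℝ}
    (hI : ∫ y, ‖w y‖ ^ 2 ≤ I₀) (hB : ∀ y, ‖w y‖ ≤ B₀) :
    Integrable (fun x => normalisedPressure w x ^ 2) ∧
      ∫ x, normalisedPressure w x ^ 2 ≤ (27 * regLaplacianMass) ^ 2 * (B₀ ^ 2 * I₀) := by
  have hmeas := aestronglyMeasurable_normalisedPressure_of_integrable hw hE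
  have hbound := eLpNorm_normalisedPressure_le_of_integrable hw hE
  have hM0 : 0 ≤ regLaplacianMass := regLaplacianMass_nonneg
  have hI0 : 0 ≤ I₀ := (integral_nonneg fun y => sq_nonneg _).trans hI
  have hsq : eLpNorm (fun y => ‖w y‖ ^ 2) 2 volume ≤ (ENNReal.ofReal (B₀ ^ 2 * I₀)) ^ (1 / 2 : ℝ) := by
    refine eLpNorm_two_le_rpow_of_lintegral_sq_le ?_
    have hpt : ∀ y, ‖‖w y‖ ^ 2‖ₑ ^ 2 ≤ ENNReal.ofReal (B₀ ^ 2 * ‖w y‖ ^ 2) := fun y => by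
      rw [Real.enorm_eq_ofReal (sq_nonneg _), ← ENNReal.ofReal_pow (sq_nonneg _)]
      refine ENNReal.ofReal_le_ofReal ?_
      have h1 : ‖w y‖ ^ 2 ≤ B₀ ^ 2 := pow_le_pow_left₀ (norm_nonneg _) (hB y) 2
      nlinarith [sq_nonneg ‖w y‖]
    calc ∫⁻ y, ‖‖w y‖ ^ 2‖ₑ ^ 2 ≤ ∫⁻ y, ENNReal.ofReal (B₀ ^ 2 * ‖w y‖ ^ 2) := lintegral_mono hpt
      _ = ENNReal.ofReal (∫ y, B₀ ^ 2 * ‖w y‖ ^ 2) := by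
          rw [ofReal_integral_eq_lintegral_ofReal (hE.const_mul _)
            (Eventually.of_forall fun y => by positivity)]
      _ ≤ ENNReal.ofReal (B₀ ^ 2 * I₀) := by
          rw [integral_const_mul]
          exact ENNReal.ofReal_le_ofReal (mul_le_mul_of_nonneg_left hI (sq_nonneg _))
  have hA : eLpNorm (normalisedPressure w) 2 volume ≤
      ENNReal.ofReal (27 * regLaplacianMass) * (ENNReal.ofReal (B₀ ^ 2 * I₀)) ^ (1 / 2 : ℝ) :=
    hbound.trans (mul_le_mul_right hsq _)
  have hAtop : ENNReal.ofReal (27 * regLaplacianMass) *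
      (ENNReal.ofReal (B₀ ^ 2 * I₀)) ^ (1 / 2 : ℝ) ≠ ⊤ :=
    ENNReal.mul_ne_top ENNReal.ofReal_ne_top
      (ENNReal.rpow_ne_top_of_nonneg (by norm_num) ENNReal.ofReal_ne_top)
  have h2 := integrable_sq_and_integral_le_of_eLpNorm_le hmeas hAtop hA
  refine ⟨h2.1, h2.2.trans (le_of_eq ?_)⟩
  rw [ENNReal.toReal_mul, ENNReal.toReal_ofReal (by positivity), ← ENNReal.toReal_rpow,
    ENNReal.toReal_ofReal (by positivity), mul_pow, ← Real.sqrt_eq_rpow,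
    Real.sq_sqrt (by positivity)]

end L2

/-! ## The three pairings of the momentum equation with `φ u` -/

section Pairings

variable {v : EuclideanSpace ℝ (Fin 3) → EuclideanSpace ℝ (Fin 3)} {φ : EuclideanSpace ℝ (Fin 3) → ℝ}

/-- A `C¹` weight with `‖Dφ‖ ≤ c` is `c`-Lipschitz. [folklore] -/
theorem lipschitzWith_of_norm_fderiv_le (hφ : ContDiff ℝ 1 φ) {c : ℝ} (hc : 0 ≤ c)
    (hDφ : ∀ x, ‖fderiv ℝ φ x‖ ≤ c) : LipschitzWith (Real.toNNReal c) φ := by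
  refine lipschitzWith_of_nnnorm_fderiv_le (hφ.differentiable one_ne_zero) fun x => ?_
  rw [← NNReal.coe_le_coe, coe_nnnorm, Real.coe_toNNReal _ hc]
  exact hDφ x

/-- **The transport pairing**: `−∫⟪u, (u·∇)u⟫ φ = ½∫|u|² ∂ᵤφ ≤ ½ c B ∫|u|²` for a `C¹`
divergence-free `u` with `|u| ≤ B`, `|u|² ∈ L¹`, and a `C¹_c` weight with `‖Dφ‖ ≤ c`. [folklore] -/
theorem transport_weight_le (hv : ContDiff ℝ 1 v) (hdiv : VectorCalculus.IsDivFree v)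
    (hφ : ContDiff ℝ 1 φ) (hφc : HasCompactSupport φ) {c B : ℝ} (hc : 0 ≤ c)
    (hDφ : ∀ x, ‖fderiv ℝ φ x‖ ≤ c) (hvB : ∀ x, ‖v x‖ ≤ B)
    (hE : Integrable fun x => ‖v x‖ ^ 2) :
    -∫ x, ⟪v x, convect v v x⟫ * φ x ≤ c * B * (∫ x, ‖v x‖ ^ 2) / 2 := by
  have hB0 : 0 ≤ B := (norm_nonneg _).trans (hvB 0)
  have hE0 : 0 ≤ ∫ x, ‖v x‖ ^ 2 := integral_nonneg fun x => sq_nonneg _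
  rw [integral_inner_convect_mul_weight hv hv hdiv (lipschitzWith_of_norm_fderiv_le hφ hc hDφ) hφc,
    neg_neg]
  have hline : ∀ x, |lineDeriv ℝ φ x (v x)| ≤ c * B := fun x => by
    rw [(hφ.differentiable one_ne_zero x).lineDeriv_eq_fderiv]
    calc |fderiv ℝ φ x (v x)| ≤ ‖fderiv ℝ φ x‖ * ‖v x‖ := by
          rw [← Real.norm_eq_abs]; exact ContinuousLinearMap.le_opNorm _ _
      _ ≤ c * B := mul_le_mul (hDφ x) (hvB x) (norm_nonneg _) hc
  have hle : ∫ x, ‖v x‖ ^ 2 * lineDeriv ℝ φ x (v x) ≤ c * B * ∫ x, ‖v x‖ ^ 2 := by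
    calc ∫ x, ‖v x‖ ^ 2 * lineDeriv ℝ φ x (v x)
        ≤ ∫ x, |‖v x‖ ^ 2 * lineDeriv ℝ φ x (v x)| := (le_abs_self _).trans abs_integral_le_integral_abs
      _ ≤ ∫ x, c * B * ‖v x‖ ^ 2 := by
          refine integral_mono_of_nonneg (Eventually.of_forall fun x => abs_nonneg _)
            (hE.const_mul _) (Eventually.of_forall fun x => ?_)
          simp only
          rw [abs_mul, abs_of_nonneg (sq_nonneg _)]
          calc ‖v x‖ ^ 2 * |lineDeriv ℝ φ x (v x)| ≤ ‖v x‖ ^ 2 * (c * B) :=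
                mul_le_mul_of_nonneg_left (hline x) (sq_nonneg _)
            _ = c * B * ‖v x‖ ^ 2 := by ring
      _ = c * B * ∫ x, ‖v x‖ ^ 2 := integral_const_mul _ _
  have hY : 0 ≤ c * B * ∫ x, ‖v x‖ ^ 2 := by positivity
  rcases le_or_gt 0 (∫ x, ‖v x‖ ^ 2 * lineDeriv ℝ φ x (v x)) with hX | hX
  · nlinarith
  · nlinarith

/-- **The viscous pairing**: `∫⟪u, Δu⟫ φ ≤ 3c (∫|u|² + ∫|Du|²)/2` for a `C²` field with
`|u|², ‖Du‖² ∈ L¹` and a nonnegative `C¹_c` weight with `‖Dφ‖ ≤ c` (the dissipation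
`−∫|Du|²_F φ ≤ 0` is discarded; the cutoff error `∫⟪u, Du eⱼ⟫ ∂ⱼφ` is bounded by
`c ∫|u||Du|`). [folklore] -/
theorem viscous_weight_le (hv : ContDiff ℝ 2 v) (hφ : ContDiff ℝ 1 φ) (hφc : HasCompactSupport φ)
    (hφ0 : ∀ x, 0 ≤ φ x) {c : ℝ} (hc : 0 ≤ c) (hDφ : ∀ x, ‖fderiv ℝ φ x‖ ≤ c)
    (hE : Integrable fun x => ‖v x‖ ^ 2) (hD : Integrable fun x => ‖fderiv ℝ v x‖ ^ 2) :
    ∫ x, ⟪v x, (Laplacian.laplacian v) x⟫ * φ x ≤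
      3 * c * ((∫ x, ‖v x‖ ^ 2) + ∫ x, ‖fderiv ℝ v x‖ ^ 2) / 2 := by
  rw [integral_inner_laplacian_mul_weight hv (lipschitzWith_of_norm_fderiv_le hφ hc hDφ) hφc]
  have hfrob : 0 ≤ ∫ x, frobeniusNormSq (fderiv ℝ v x) * φ x :=
    integral_nonneg fun x => mul_nonneg (frobeniusNormSq_nonneg _) (hφ0 x)
  have hE0 : 0 ≤ ∫ x, ‖v x‖ ^ 2 := integral_nonneg fun x => sq_nonneg _
  have hD0 : 0 ≤ ∫ x, ‖fderiv ℝ v x‖ ^ 2 := integral_nonneg fun x => sq_nonneg _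
  have hline : ∀ (j : Fin 3) x, |lineDeriv ℝ φ x (EuclideanSpace.single j 1)| ≤ c := fun j x => by
    rw [(hφ.differentiable one_ne_zero x).lineDeriv_eq_fderiv]
    calc |fderiv ℝ φ x (EuclideanSpace.single j 1)|
        ≤ ‖fderiv ℝ φ x‖ * ‖(EuclideanSpace.single j (1 : ℝ))‖ := by
          rw [← Real.norm_eq_abs]; exact ContinuousLinearMap.le_opNorm _ _
      _ = ‖fderiv ℝ φ x‖ := by rw [PiLp.norm_single, norm_one, mul_one]
      _ ≤ c := hDφ x
  have hterm : ∀ j : Fin 3, |∫ x, ⟪v x, fderiv ℝ v x (EuclideanSpace.single j 1)⟫ *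
      lineDeriv ℝ φ x (EuclideanSpace.single j 1)| ≤
      c * (((∫ x, ‖v x‖ ^ 2) + ∫ x, ‖fderiv ℝ v x‖ ^ 2) / 2) := by
    intro j
    have hpt : ∀ x, |⟪v x, fderiv ℝ v x (EuclideanSpace.single j 1)⟫ *
        lineDeriv ℝ φ x (EuclideanSpace.single j 1)| ≤
        c * ((‖v x‖ ^ 2 + ‖fderiv ℝ v x‖ ^ 2) / 2) := fun x => by
      rw [abs_mul]
      have h1 : |⟪v x, fderiv ℝ v x (EuclideanSpace.single j 1)⟫| ≤ ‖v x‖ * ‖fderiv ℝ v x‖ := by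
        refine (abs_real_inner_le_norm _ _).trans (mul_le_mul_of_nonneg_left ?_ (norm_nonneg _))
        calc ‖fderiv ℝ v x (EuclideanSpace.single j 1)‖
            ≤ ‖fderiv ℝ v x‖ * ‖(EuclideanSpace.single j (1 : ℝ))‖ := ContinuousLinearMap.le_opNorm _ _
          _ = ‖fderiv ℝ v x‖ := by rw [PiLp.norm_single, norm_one, mul_one]
      have h2 : ‖v x‖ * ‖fderiv ℝ v x‖ ≤ (‖v x‖ ^ 2 + ‖fderiv ℝ v x‖ ^ 2) / 2 := by
        nlinarith [sq_nonneg (‖v x‖ - ‖fderiv ℝ v x‖)]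
      calc |⟪v x, fderiv ℝ v x (EuclideanSpace.single j 1)⟫| *
            |lineDeriv ℝ φ x (EuclideanSpace.single j 1)|
          ≤ ((‖v x‖ ^ 2 + ‖fderiv ℝ v x‖ ^ 2) / 2) * c :=
            mul_le_mul (h1.trans h2) (hline j x) (abs_nonneg _) (by positivity)
        _ = c * ((‖v x‖ ^ 2 + ‖fderiv ℝ v x‖ ^ 2) / 2) := by ring
    calc |∫ x, ⟪v x, fderiv ℝ v x (EuclideanSpace.single j 1)⟫ *
          lineDeriv ℝ φ x (EuclideanSpace.single j 1)|
        ≤ ∫ x, |⟪v x, fderiv ℝ v x (EuclideanSpace.single j 1)⟫ *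
          lineDeriv ℝ φ x (EuclideanSpace.single j 1)| := abs_integral_le_integral_abs
      _ ≤ ∫ x, c * ((‖v x‖ ^ 2 + ‖fderiv ℝ v x‖ ^ 2) / 2) :=
          integral_mono_of_nonneg (Eventually.of_forall fun x => abs_nonneg _)
            (((hE.add hD).div_const 2).const_mul _) (Eventually.of_forall hpt)
      _ = c * (((∫ x, ‖v x‖ ^ 2) + ∫ x, ‖fderiv ℝ v x‖ ^ 2) / 2) := by
          rw [integral_const_mul, integral_div, integral_add hE hD]
  have hsum : |∑ j : Fin 3, ∫ x, ⟪v x, fderiv ℝ v x (EuclideanSpace.single j 1)⟫ *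
      lineDeriv ℝ φ x (EuclideanSpace.single j 1)| ≤
      3 * (c * (((∫ x, ‖v x‖ ^ 2) + ∫ x, ‖fderiv ℝ v x‖ ^ 2) / 2)) := by
    calc |∑ j : Fin 3, ∫ x, ⟪v x, fderiv ℝ v x (EuclideanSpace.single j 1)⟫ *
          lineDeriv ℝ φ x (EuclideanSpace.single j 1)|
        ≤ ∑ j : Fin 3, |∫ x, ⟪v x, fderiv ℝ v x (EuclideanSpace.single j 1)⟫ *
          lineDeriv ℝ φ x (EuclideanSpace.single j 1)| := Finset.abs_sum_le_sum_abs _ _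
      _ ≤ ∑ _j : Fin 3, c * (((∫ x, ‖v x‖ ^ 2) + ∫ x, ‖fderiv ℝ v x‖ ^ 2) / 2) :=
          Finset.sum_le_sum fun j _ => hterm j
      _ = 3 * (c * (((∫ x, ‖v x‖ ^ 2) + ∫ x, ‖fderiv ℝ v x‖ ^ 2) / 2)) := by simp
  have habs := (neg_le_abs _).trans hsum
  linarith

/-- **The pressure pairing, identity**: for `q ∈ C¹`, `u ∈ C¹` divergence free and `φ ∈ C¹_c`,
`∫⟪∇q, φ u⟫ = −∫ q ⟪u, ∇φ⟫` (`div (φ u) = φ div u + ⟪u, ∇φ⟫ = ⟪u, ∇φ⟫`), and the constant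
part of `q` drops out (`∫⟪u, ∇φ⟫ = −∫ φ div u = 0`): if `q = Q + c₀` then
`∫⟪∇q, φ u⟫ = −∫ Q ⟪u, ∇φ⟫`, provided `Q ⟪u, ∇φ⟫ ∈ L¹`. [folklore] -/
theorem integral_inner_gradient_smul_eq {q Q : EuclideanSpace ℝ (Fin 3) → ℝ} {c₀ : ℝ}
    (hq : ContDiff ℝ 1 q) (hqQ : ∀ x, q x = Q x + c₀) (hv : ContDiff ℝ 1 v)
    (hdiv : VectorCalculus.IsDivFree v) (hφ : ContDiff ℝ 1 φ) (hφc : HasCompactSupport φ)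
    (hQi : Integrable fun x => Q x * ⟪v x, gradient φ x⟫) :
    ∫ x, ⟪gradient q x, φ x • v x⟫ = -∫ x, Q x * ⟪v x, gradient φ x⟫ := by
  rw [integral_inner_gradient_eq_neg_integral_mul_divergence (ψ := fun y => φ y • v y) hq
    (hφ.smul hv) (hφc.smul_right (f' := v))]
  congr 1
  have hdiv_eq : ∀ x, VectorCalculus.divergence (fun y => φ y • v y) x = ⟪v x, gradient φ x⟫ := fun x => by
    rw [divergence_smul_apply (hφ.differentiable one_ne_zero x) (hv.differentiable one_ne_zero x),
      hdiv x, mul_zero, zero_add]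
  have hzero : ∫ x, ⟪v x, gradient φ x⟫ = 0 := by
    have h1 := integral_mul_divergence_add_eq_zero_left hφ hv hφc
    have h0 : ∫ x, φ x * VectorCalculus.divergence v x = 0 := by simp [hdiv _]
    linarith
  have iG : Integrable fun x => ⟪v x, gradient φ x⟫ := by
    refine (hv.continuous.inner (continuous_gradient_of_contDiff hφ)).integrable_of_hasCompactSupport
      ((hφc.fderiv (𝕜 := ℝ)).mono fun x hx => ?_)
    rw [mem_support] at hx ⊢
    contrapose! hx
    rw [gradient, hx, map_zero, inner_zero_right]
  calc ∫ x, q x * VectorCalculus.divergence (fun y => φ y • v y) x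
      = ∫ x, (Q x * ⟪v x, gradient φ x⟫ + c₀ * ⟪v x, gradient φ x⟫) :=
        integral_congr_ae (Eventually.of_forall fun x => by
          simp only; rw [hdiv_eq, hqQ x]; ring)
    _ = (∫ x, Q x * ⟪v x, gradient φ x⟫) + c₀ * ∫ x, ⟪v x, gradient φ x⟫ := by
        rw [integral_add hQi (iG.const_mul _), integral_const_mul]
    _ = ∫ x, Q x * ⟪v x, gradient φ x⟫ := by rw [hzero, mul_zero, add_zero]

/-- **The pressure pairing, bound**: `|∫ Q ⟪u, ∇φ⟫| ≤ c (∫Q² + ∫|u|²)/2` when `‖Dφ‖ ≤ c`,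
`Q², |u|² ∈ L¹` (`|Q ⟪u, ∇φ⟫| ≤ c |Q||u| ≤ c (Q² + |u|²)/2`); in particular the integrand is
integrable. [folklore] -/
theorem pressure_weight_le {Q : EuclideanSpace ℝ (Fin 3) → ℝ} (hQm : AEStronglyMeasurable Q volume)
    (hQ2 : Integrable fun x => Q x ^ 2) (hvc : Continuous v) (hE : Integrable fun x => ‖v x‖ ^ 2)
    (hφ : ContDiff ℝ 1 φ) {c : ℝ} (hc : 0 ≤ c) (hDφ : ∀ x, ‖fderiv ℝ φ x‖ ≤ c) :
    Integrable (fun x => Q x * ⟪v x, gradient φ x⟫) ∧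
      |∫ x, Q x * ⟪v x, gradient φ x⟫| ≤ c * ((∫ x, Q x ^ 2) + ∫ x, ‖v x‖ ^ 2) / 2 := by
  have hg : ∀ x, |⟪v x, gradient φ x⟫| ≤ c * ‖v x‖ := fun x => by
    calc |⟪v x, gradient φ x⟫| ≤ ‖v x‖ * ‖gradient φ x‖ := abs_real_inner_le_norm _ _
      _ ≤ ‖v x‖ * c := by
          refine mul_le_mul_of_nonneg_left ?_ (norm_nonneg _)
          rw [gradient, LinearIsometryEquiv.norm_map]; exact hDφ x
      _ = c * ‖v x‖ := by ring
  have hpt : ∀ x, |Q x * ⟪v x, gradient φ x⟫| ≤ c * ((Q x ^ 2 + ‖v x‖ ^ 2) / 2) := fun x => by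
    rw [abs_mul]
    have h1 : |Q x| * |⟪v x, gradient φ x⟫| ≤ |Q x| * (c * ‖v x‖) :=
      mul_le_mul_of_nonneg_left (hg x) (abs_nonneg _)
    have h2 : |Q x| * ‖v x‖ ≤ (Q x ^ 2 + ‖v x‖ ^ 2) / 2 := by
      nlinarith [sq_nonneg (|Q x| - ‖v x‖), sq_abs (Q x)]
    calc |Q x| * |⟪v x, gradient φ x⟫| ≤ |Q x| * (c * ‖v x‖) := h1
      _ = c * (|Q x| * ‖v x‖) := by ring
      _ ≤ c * ((Q x ^ 2 + ‖v x‖ ^ 2) / 2) := mul_le_mul_of_nonneg_left h2 hc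
  have hmeas : AEStronglyMeasurable (fun x => Q x * ⟪v x, gradient φ x⟫) volume :=
    hQm.mul (hvc.inner (continuous_gradient_of_contDiff hφ)).aestronglyMeasurable
  have hint : Integrable fun x => Q x * ⟪v x, gradient φ x⟫ :=
    (((hQ2.add hE).div_const 2).const_mul c).mono' hmeas (Eventually.of_forall fun x => by
      rw [Real.norm_eq_abs]; exact hpt x)
  refine ⟨hint, ?_⟩
  calc |∫ x, Q x * ⟪v x, gradient φ x⟫| ≤ ∫ x, |Q x * ⟪v x, gradient φ x⟫| := abs_integral_le_integral_abs
    _ ≤ ∫ x, c * ((Q x ^ 2 + ‖v x‖ ^ 2) / 2) :=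
        integral_mono_of_nonneg (Eventually.of_forall fun x => abs_nonneg _)
          (((hQ2.add hE).div_const 2).const_mul c) (Eventually.of_forall hpt)
    _ = c * ((∫ x, Q x ^ 2) + ∫ x, ‖v x‖ ^ 2) / 2 := by
        rw [integral_const_mul, integral_div, integral_add hQ2 hE]; ring

end Pairings

/-! ## The energy inequality -/

section Energy

variable {T ν : ℝ} {u : ℝ → (EuclideanSpace ℝ (Fin 3)) → (EuclideanSpace ℝ (Fin 3))}
  {p : ℝ → (EuclideanSpace ℝ (Fin 3)) → ℝ}

/-- The derivative of the fourth power of the cutoff: `‖D(χ_R⁴)(x)‖ ≤ 4 C/R` when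
`‖Dχ_R‖ ≤ C/R` (`0 ≤ χ_R ≤ 1`). [folklore] -/
theorem norm_fderiv_cutoff_pow_four_le {C R : ℝ}
    (hC : ∀ x : EuclideanSpace ℝ (Fin 3), ‖fderiv ℝ (cutoff R) x‖ ≤ C / R)
    (x : EuclideanSpace ℝ (Fin 3)) :
    ‖fderiv ℝ (fun y => cutoff R y ^ 4) x‖ ≤ 4 * (C / R) := by
  have hd : DifferentiableAt ℝ (cutoff R) x :=
    ((contDiff_cutoff (n := 1) R).differentiable one_ne_zero x)
  have hF := hd.hasFDerivAt.pow 4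
  rw [hF.fderiv, norm_smul]
  have h1 : ‖(4 : ℕ) • cutoff R x ^ (4 - 1)‖ ≤ 4 := by
    rw [nsmul_eq_mul, show (4 - 1 : ℕ) = 3 from rfl, Nat.cast_ofNat, Real.norm_eq_abs, abs_mul,
      abs_of_nonneg (by norm_num : (0 : ℝ) ≤ 4), abs_of_nonneg (pow_nonneg (cutoff_nonneg R x) 3)]
    have := pow_le_one₀ (cutoff_nonneg R x) (cutoff_le_one R x) (n := 3)
    linarith
  exact mul_le_mul h1 (hC x) (norm_nonneg _) (by norm_num)

/-- **The localised energy balance at an interior time is `O(1/R)`.** For `ν ≥ 0` and an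
unforced classical solution on `[0, T] × ℝ³` with `|u| ≤ B₀`, `∫|u(τ)|² ≤ I₀`, `∫‖Du(τ)‖² ≤ I₁`
on `[0, T]`, whose pressure at the interior time `τ` is `Q[u(τ)] + c₀` with `∫ Q[u(τ)]² ≤ Q₀`,
and the cutoff `χ_R` with `‖Dχ_R‖ ≤ C/R`, `R ≥ 1`:
`∫ χ_R⁴ ⟪∂ₜu(τ), u(τ)⟫ ≤ 4C (B₀I₀/2 + 3ν(I₀ + I₁)/2 + (Q₀ + I₀)/2)/R`. [folklore] -/
theorem IsClassicalNSSolutionOn.energy_slice_le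
    (h : IsClassicalNSSolutionOn (Icc 0 T) ν 0 u p) (hν : 0 ≤ ν) {τ : ℝ} (hτ : τ ∈ Icc 0 T)
    {B₀ I₀ I₁ Q₀ C c₀ : ℝ} (hC0 : 0 ≤ C)
    (hC : ∀ R : ℝ, 0 < R → ∀ x : EuclideanSpace ℝ (Fin 3), ‖fderiv ℝ (cutoff R) x‖ ≤ C / R)
    (huB : ∀ x, ‖u τ x‖ ≤ B₀) (hE : Integrable fun x => ‖u τ x‖ ^ 2)
    (hEle : ∫ x, ‖u τ x‖ ^ 2 ≤ I₀) (hD : Integrable fun x => ‖fderiv ℝ (u τ) x‖ ^ 2)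
    (hDle : ∫ x, ‖fderiv ℝ (u τ) x‖ ^ 2 ≤ I₁)
    (hQ : ∀ x, p τ x = normalisedPressure (u τ) x + c₀)
    (hQ2 : Integrable fun x => normalisedPressure (u τ) x ^ 2)
    (hQle : ∫ x, normalisedPressure (u τ) x ^ 2 ≤ Q₀) {R : ℝ} (hR : 1 ≤ R) :
    ∫ x, cutoff R x ^ 4 * ⟪timeDerivWithin (Icc 0 T) u τ x, u τ x⟫ ≤
      4 * C * (B₀ * I₀ / 2 + ν * (3 * (I₀ + I₁) / 2) + (Q₀ + I₀) / 2) / R := by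
  have hR0 : 0 < R := by linarith
  have hv : ContDiff ℝ ∞ (u τ) := h.contDiff_velocity hτ
  have hv1 : ContDiff ℝ 1 (u τ) := hv.of_le (by norm_cast)
  have hv2 : ContDiff ℝ 2 (u τ) := hv.of_le (by norm_cast)
  have hdiv : VectorCalculus.IsDivFree (u τ) := h.divFree τ hτ
  have hp1 : ContDiff ℝ 1 (p τ) := (h.contDiff_pressure hτ).of_le (by norm_cast)
  have hB0 : 0 ≤ B₀ := (norm_nonneg _).trans (huB 0)
  have hE0 : 0 ≤ ∫ x, ‖u τ x‖ ^ 2 := integral_nonneg fun x => sq_nonneg _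
  have hD0 : 0 ≤ ∫ x, ‖fderiv ℝ (u τ) x‖ ^ 2 := integral_nonneg fun x => sq_nonneg _
  have hQ0 : 0 ≤ ∫ x, normalisedPressure (u τ) x ^ 2 := integral_nonneg fun x => sq_nonneg _
  -- the weight `φ = χ_R⁴`
  set φ : (EuclideanSpace ℝ (Fin 3)) → ℝ := fun y => cutoff R y ^ 4 with hφ
  have hφ1 : ContDiff ℝ 1 φ := ((contDiff_cutoff R).pow 4).of_le (by norm_cast)
  have hφc : HasCompactSupport φ := hasCompactSupport_pow (hasCompactSupport_cutoff hR0) (by norm_num)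
  have hφcont : Continuous φ := hφ1.continuous
  have hφ0 : ∀ x, 0 ≤ φ x := fun x => pow_nonneg (cutoff_nonneg R x) 4
  have hDφ : ∀ x, ‖fderiv ℝ φ x‖ ≤ 4 * (C / R) := fun x => norm_fderiv_cutoff_pow_four_le (hC R hR0) x
  have hcR0 : 0 ≤ 4 * (C / R) := by positivity
  -- the three pairings
  have hT1 := transport_weight_le hv1 hdiv hφ1 hφc hcR0 hDφ huB hE
  have hT2 := viscous_weight_le hv2 hφ1 hφc hφ0 hcR0 hDφ hE hD
  obtain ⟨hQi, hT3⟩ := pressure_weight_le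
    (aestronglyMeasurable_normalisedPressure_of_integrable hv hE) hQ2 hv.continuous hE hφ1 hcR0 hDφ
  have hT3' := integral_inner_gradient_smul_eq hp1 hQ hv1 hdiv hφ1 hφc hQi
  -- the momentum equation paired with `φ u`
  have hmom : ∀ x, timeDerivWithin (Icc 0 T) u τ x =
      -convect (u τ) (u τ) x + ν • (Laplacian.laplacian (u τ)) x - gradient (p τ) x := fun x => by
    have hm := h.momentum τ hτ x
    simp only [Pi.zero_apply, add_zero] at hm
    calc timeDerivWithin (Icc 0 T) u τ x
        = (timeDerivWithin (Icc 0 T) u τ x + convect (u τ) (u τ) x) - convect (u τ) (u τ) x := by abel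
      _ = _ := by rw [hm]; abel
  have cconv : Continuous (convect (u τ) (u τ)) := by
    show Continuous fun x => fderiv ℝ (u τ) x (u τ x)
    exact (hv.continuous_fderiv (by simp)).clm_apply hv.continuous
  have clap : Continuous (Laplacian.laplacian (u τ)) := continuous_laplacian hv2
  have cgrad : Continuous (gradient (p τ)) := continuous_gradient_of_contDiff hp1
  have i1 : Integrable fun x => ⟪u τ x, convect (u τ) (u τ) x⟫ * φ x :=
    ((hv.continuous.inner cconv).mul hφcont).integrable_of_hasCompactSupport hφc.mul_left
  have i2 : Integrable fun x => ⟪u τ x, (Laplacian.laplacian (u τ)) x⟫ * φ x :=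
    ((hv.continuous.inner clap).mul hφcont).integrable_of_hasCompactSupport hφc.mul_left
  have i3 : Integrable fun x => ⟪gradient (p τ) x, φ x • u τ x⟫ := by
    refine (cgrad.inner (hφcont.smul hv.continuous)).integrable_of_hasCompactSupport
      ((hφc.smul_right (f' := u τ)).mono fun x hx => ?_)
    rw [mem_support] at hx ⊢
    contrapose! hx
    have hx' : φ x • u τ x = 0 := hx
    rw [hx', inner_zero_right]
  have hsplit : ∫ x, φ x * ⟪timeDerivWithin (Icc 0 T) u τ x, u τ x⟫ =
      -(∫ x, ⟪u τ x, convect (u τ) (u τ) x⟫ * φ x) +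
        ν * (∫ x, ⟪u τ x, (Laplacian.laplacian (u τ)) x⟫ * φ x) -
        ∫ x, ⟪gradient (p τ) x, φ x • u τ x⟫ := by
    have i1n : Integrable fun x => -(⟪u τ x, convect (u τ) (u τ) x⟫ * φ x) := i1.neg
    have i2ν : Integrable fun x => ν * (⟪u τ x, (Laplacian.laplacian (u τ)) x⟫ * φ x) := i2.const_mul ν
    calc ∫ x, φ x * ⟪timeDerivWithin (Icc 0 T) u τ x, u τ x⟫
        = ∫ x, ((-(⟪u τ x, convect (u τ) (u τ) x⟫ * φ x) +
            ν * (⟪u τ x, (Laplacian.laplacian (u τ)) x⟫ * φ x)) - ⟪gradient (p τ) x, φ x • u τ x⟫) := by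
          refine integral_congr_ae (Eventually.of_forall fun x => ?_)
          simp only
          rw [hmom x, inner_sub_left, inner_add_left, inner_neg_left, real_inner_smul_left,
            real_inner_comm (convect (u τ) (u τ) x), real_inner_comm ((Laplacian.laplacian (u τ)) x),
            real_inner_smul_right]
          ring
      _ = ((∫ x, -(⟪u τ x, convect (u τ) (u τ) x⟫ * φ x)) +
            ∫ x, ν * (⟪u τ x, (Laplacian.laplacian (u τ)) x⟫ * φ x)) -
            ∫ x, ⟪gradient (p τ) x, φ x • u τ x⟫ := by
          have i12 : Integrable fun x => -(⟪u τ x, convect (u τ) (u τ) x⟫ * φ x) +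
              ν * (⟪u τ x, (Laplacian.laplacian (u τ)) x⟫ * φ x) := i1n.add i2ν
          rw [integral_sub i12 i3, integral_add i1n i2ν]
      _ = _ := by rw [integral_neg, integral_const_mul]
  have e : 4 * C * (B₀ * I₀ / 2 + ν * (3 * (I₀ + I₁) / 2) + (Q₀ + I₀) / 2) / R =
      4 * (C / R) * B₀ * I₀ / 2 + ν * (3 * (4 * (C / R)) * (I₀ + I₁) / 2) +
        4 * (C / R) * (Q₀ + I₀) / 2 := by
    field_simp
  have hT1' : -∫ x, ⟪u τ x, convect (u τ) (u τ) x⟫ * φ x ≤ 4 * (C / R) * B₀ * I₀ / 2 :=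
    hT1.trans (by gcongr)
  have hT2' : ν * ∫ x, ⟪u τ x, (Laplacian.laplacian (u τ)) x⟫ * φ x ≤
      ν * (3 * (4 * (C / R)) * (I₀ + I₁) / 2) :=
    mul_le_mul_of_nonneg_left (hT2.trans (by gcongr)) hν
  have hT3'' : -∫ x, ⟪gradient (p τ) x, φ x • u τ x⟫ ≤ 4 * (C / R) * (Q₀ + I₀) / 2 := by
    rw [hT3', neg_neg]
    exact ((le_abs_self _).trans hT3).trans (by gcongr)
  calc ∫ x, cutoff R x ^ 4 * ⟪timeDerivWithin (Icc 0 T) u τ x, u τ x⟫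
      = ∫ x, φ x * ⟪timeDerivWithin (Icc 0 T) u τ x, u τ x⟫ := rfl
    _ ≤ _ := by rw [hsplit, e]; linarith

/-- **The energy inequality in the Beale–Kato–Majda class, `ν ≥ 0`** (Majda–Bertozzi Prop. 3.1
with (3.7), no forcing: `sup_t ‖v(t)‖₀ ≤ ‖v₀‖₀`). For `ν ≥ 0`, `T > 0` and an unforced classical
solution `(u, p)` on `[0, T] × ℝ³` with all `L²` Sobolev seminorms of `u` bounded on `[0, T]`:
`∫|u(t)|² ≤ ∫|u(0)|²` for every `t ∈ [0, T]`. The pressure gradient is the canonical one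
(`pressure_sub_pressurePotential_eq`, Tao's Lemma 4.1 (i), proved in the tree for `ν ≥ 0`), which
is in `L²`, so that the printed integration by parts `−(∇p, v) = (p, div v) = 0` is available
after localisation by `χ_R⁴` and `R → ∞`. [cite: MajdaBertozzi2002, §3.1.1 Prop. 3.1 with (3.7) (p. 88); §3.3 (3.79), m = 0 (p. 116)] -/
theorem IsClassicalNSSolutionOn.bkm_energy_le
    (h : IsClassicalNSSolutionOn (Icc 0 T) ν 0 u p) (hν : 0 ≤ ν) (hT : 0 < T)
    (hB : HasBoundedSobolevNormsOn (Icc 0 T) u) {t : ℝ} (ht : t ∈ Icc 0 T) :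
    ∫ x, ‖u t x‖ ^ 2 ≤ ∫ x, ‖u 0 x‖ ^ 2 := by
  have hU := uniqueDiffOn_Icc hT
  have h0T : (0 : ℝ) ∈ Icc 0 T := ⟨le_rfl, hT.le⟩
  have hu : ∀ τ ∈ Icc 0 T, ContDiff ℝ ∞ (u τ) := fun τ hτ => h.contDiff_velocity hτ
  -- bounds in the class: energy, gradient energy, sup of `u`
  obtain ⟨⟨I₀, hI₀⟩, -⟩ := levelSq_bounds_of_hasBoundedSobolevNormsOn hu hB 0
  obtain ⟨⟨I₁, hI₁⟩, -⟩ := levelSq_bounds_of_hasBoundedSobolevNormsOn hu hB 1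
  obtain ⟨B₀, hB₀0, hB₀⟩ := exists_forall_norm_iteratedFDeriv_le_bkmClass hu hB 0
  have huB : ∀ τ ∈ Icc 0 T, ∀ x, ‖u τ x‖ ≤ B₀ := fun τ hτ x => by
    have := hB₀ τ hτ x; rwa [norm_iteratedFDeriv_zero] at this
  have hE_int : ∀ τ ∈ Icc 0 T, Integrable fun x => ‖u τ x‖ ^ 2 := fun τ hτ =>
    (hI₀ τ hτ).1.congr (Eventually.of_forall fun x => levelSq_zero_eq_norm_sq (u τ) x)
  have hE_le : ∀ τ ∈ Icc 0 T, ∫ x, ‖u τ x‖ ^ 2 ≤ I₀ := fun τ hτ => by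
    rw [← integral_congr_ae (Eventually.of_forall fun x => levelSq_zero_eq_norm_sq (u τ) x)]
    exact (hI₀ τ hτ).2
  have hE0 : ∀ τ ∈ Icc 0 T, 0 ≤ ∫ x, ‖u τ x‖ ^ 2 := fun τ _ => integral_nonneg fun x => sq_nonneg _
  have hI₀0 : 0 ≤ I₀ := (hE0 0 h0T).trans (hE_le 0 h0T)
  have hD_int : ∀ τ ∈ Icc 0 T, Integrable fun x => ‖fderiv ℝ (u τ) x‖ ^ 2 := fun τ hτ =>
    (hI₁ τ hτ).1.mono' ((((hu τ hτ).continuous_fderiv (by simp)).norm).pow 2).aestronglyMeasurable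
      (Eventually.of_forall fun x => by
        rw [Real.norm_of_nonneg (sq_nonneg _)]; exact sq_norm_fderiv_le_levelSq_one (hu τ hτ) x)
  have hD_le : ∀ τ ∈ Icc 0 T, ∫ x, ‖fderiv ℝ (u τ) x‖ ^ 2 ≤ I₁ := fun τ hτ =>
    (integral_mono (hD_int τ hτ) (hI₁ τ hτ).1 fun x => sq_norm_fderiv_le_levelSq_one (hu τ hτ) x).trans
      (hI₁ τ hτ).2
  have hI₁0 : 0 ≤ I₁ := (integral_nonneg fun x => sq_nonneg _).trans (hD_le 0 h0T)
  -- the normalised pressure at interior times and its `L²` bound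
  have hQ : ∀ τ ∈ Ioo 0 T, ∀ x,
      p τ x = normalisedPressure (u τ) x + (p τ 0 - pressurePotential (u τ) 0) := by
    intro τ hτ x
    have hτ' : τ ∈ Icc 0 T := Ioo_subset_Icc_self hτ
    have h1 := pressure_sub_pressurePotential_eq hν h hI₀0 hE_int hE_le hτ x
    rw [normalisedPressure_eq_pressurePotential ((hu τ hτ').of_le (by norm_cast)) (hE_int τ hτ') x]
    linarith
  set Q₀ : ℝ := (27 * regLaplacianMass) ^ 2 * (B₀ ^ 2 * I₀) with hQ₀
  have hQL2 : ∀ τ ∈ Icc 0 T, Integrable (fun x => normalisedPressure (u τ) x ^ 2) ∧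
      ∫ x, normalisedPressure (u τ) x ^ 2 ≤ Q₀ := fun τ hτ =>
    integral_normalisedPressure_sq_le_of_bound (hu τ hτ) (hE_int τ hτ) (hE_le τ hτ) (huB τ hτ)
  -- the cutoff and the slice bound
  obtain ⟨C, hC0, hC⟩ := exists_norm_fderiv_cutoff_le (E := (EuclideanSpace ℝ (Fin 3)))
  set K : ℝ := 4 * C * (B₀ * I₀ / 2 + ν * (3 * (I₀ + I₁) / 2) + (Q₀ + I₀) / 2) with hK
  have hQ₀0 : 0 ≤ Q₀ := by rw [hQ₀]; positivity
  have hK0 : 0 ≤ K := by rw [hK]; positivity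
  have hslice : ∀ R : ℝ, 1 ≤ R → ∀ τ ∈ Ioo 0 T,
      ∫ x, cutoff R x ^ 4 * ⟪timeDerivWithin (Icc 0 T) u τ x, u τ x⟫ ≤ K / R := by
    intro R hR1 τ hτ
    have hτ' : τ ∈ Icc 0 T := Ioo_subset_Icc_self hτ
    exact h.energy_slice_le hν hτ' hC0 hC (huB τ hτ') (hE_int τ hτ') (hE_le τ hτ') (hD_int τ hτ')
      (hD_le τ hτ') (hQ τ hτ) (hQL2 τ hτ').1 (hQL2 τ hτ').2 hR1
  -- time integration and removal of the cutoff
  have hXint : Integrable fun x => ‖u t x‖ ^ 2 := hE_int t ht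
  have hR : ∀ R : ℝ, 1 ≤ R →
      ∫ x, cutoff R x ^ 4 * ‖u t x‖ ^ 2 ≤ (∫ x, ‖u 0 x‖ ^ 2) + 2 * (T * (K / R)) := by
    intro R hR1
    have hR0 : 0 < R := by linarith
    have hφcont : Continuous fun y : EuclideanSpace ℝ (Fin 3) => cutoff R y ^ 4 :=
      (contDiff_cutoff (n := 0) R).continuous.pow 4
    have hφc : HasCompactSupport fun y : EuclideanSpace ℝ (Fin 3) => cutoff R y ^ 4 :=
      hasCompactSupport_pow (hasCompactSupport_cutoff hR0) (by norm_num)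
    have hid := h.smooth_velocity.integral_Ioo_integral_mul_inner_timeDerivWithin hT hφcont hφc
      le_rfl ht.1 ht.2
    have hcont : ContinuousOn (fun τ => ∫ x, cutoff R x ^ 4 *
        ⟪timeDerivWithin (Icc 0 T) u τ x, u τ x⟫) (Icc 0 T) := by
      have hG : ContinuousOn (fun z : ℝ × EuclideanSpace ℝ (Fin 3) =>
          ⟪timeDerivWithin (Icc 0 T) u z.1 z.2, u z.1 z.2⟫) (Icc 0 T ×ˢ univ) :=
        (h.smooth_velocity.timeDerivWithin hU).continuousOn.inner h.smooth_velocity.continuousOn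
      exact continuousOn_integral_mul_of_continuousOn hφcont hφc hG
    have hint : IntegrableOn (fun τ => ∫ x, cutoff R x ^ 4 *
        ⟪timeDerivWithin (Icc 0 T) u τ x, u τ x⟫) (Ioo 0 t) :=
      integrableOn_Ioo_of_continuousOn hcont ht
    have hle : ∫ τ in Ioo 0 t, ∫ x, cutoff R x ^ 4 * ⟪timeDerivWithin (Icc 0 T) u τ x, u τ x⟫ ≤
        ∫ _ in Ioo (0 : ℝ) t, K / R := by
      refine setIntegral_mono_on hint
        (integrableOn_const (by rw [Real.volume_Ioo]; exact ENNReal.ofReal_ne_top))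
        measurableSet_Ioo fun τ hτ => hslice R hR1 τ ⟨hτ.1, hτ.2.trans_le ht.2⟩
    rw [setIntegral_const, Real.volume_real_Ioo, sub_zero, max_eq_left ht.1, smul_eq_mul] at hle
    have h0 : ∫ x, cutoff R x ^ 4 * ‖u 0 x‖ ^ 2 ≤ ∫ x, ‖u 0 x‖ ^ 2 := by
      refine integral_mono ?_ (hE_int 0 h0T) fun x => ?_
      · exact (hφcont.mul ((h.contDiff_velocity h0T).continuous.norm.pow 2)).integrable_of_hasCompactSupport
          hφc.mul_right
      · calc cutoff R x ^ 4 * ‖u 0 x‖ ^ 2 ≤ 1 * ‖u 0 x‖ ^ 2 :=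
            mul_le_mul_of_nonneg_right (pow_le_one₀ (cutoff_nonneg R x) (cutoff_le_one R x))
              (sq_nonneg _)
          _ = ‖u 0 x‖ ^ 2 := one_mul _
    have hKt : t * (K / R) ≤ T * (K / R) := mul_le_mul_of_nonneg_right ht.2 (div_nonneg hK0 hR0.le)
    linarith [hid, hle, h0, hKt]
  have hlim1 := tendsto_integral_cutoff_pow_mul_atTop hXint 4
  have hlim2 : Tendsto (fun R : ℝ => (∫ x, ‖u 0 x‖ ^ 2) + 2 * (T * (K / R))) atTop
      (𝓝 ((∫ x, ‖u 0 x‖ ^ 2) + 2 * (T * 0))) := by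
    refine tendsto_const_nhds.add (Tendsto.const_mul 2 (Tendsto.const_mul T ?_))
    simpa using (tendsto_const_nhds (x := K)).div_atTop tendsto_id
  rw [mul_zero, mul_zero, add_zero] at hlim2
  exact le_of_tendsto_of_tendsto hlim1 hlim2 (eventually_atTop.2 ⟨1, hR⟩)

end Energy

end Literature.Analysis.FluidPDE
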